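import Summits.AtomisticToContinuum.Crystallization.Theorems.MinimiserShells.Negative.UniformRooting

/-!
# Negative knowledge for crux `MinimiserShells` (stmt-AtomisticToContinuum-9225) — REFLECTION SYMMETRY
# of the law does not substitute for point-stationarity (standing disprover, gen 2)

`IsReflectionSymmetricLaw P` is the Mecke identity restricted to transports `g(μ, y) = k(y)` that do
not look at the configuration (`E_P Σ_y k(y) = E_P Σ_y k(−y)`); every point-stationary law has it
(`IsPointStationaryLaw.isReflectionSymmetricLaw`).  With point-stationarity WEAKENED to it, the crux
`PalmUnimodularRigidity.MinimiserShells` is FALSE (`minimiserShells_false_withReflectionOnly`): the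
deterministic SYMMETRIC COMB `symComb m` — the collinear comb of `LoadBearing` together with its mirror
image — is `1/(2(m+1))`-separated (`symComb_separated`), symmetric (`sum_symComb_neg`), has root
energy `≤ −m/1000 ≤ e*` for `m = ⌈−2000 e*⌉₊` (`rootEnergy_symComb_le_eStar`) and an empty root shell
(`not_goodShell_symComb`).  Moral: a proof must re-root GENUINELY, with transports depending on
`θ_y μ`; the evenness of the Palm intensity comes for free and buys nothing.

Supports item stmt-AtomisticToContinuum-9225; workfile `Cruxes/MinimiserShells/Disproof.lean` §6c.
-/

noncomputable section

open MeasureTheory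
open scoped ENNReal BigOperators

namespace Summit.AtomisticToContinuum.Crystallization.Theorems.MinimiserShells.Negative.ReflectionOnly

open Literature.Probability.Process
open Literature.MathematicalPhysics.StatisticalMechanics
open Literature.Geometry.DiscreteGeometry
open Summit.AtomisticToContinuum.Crystallization.Theses.PalmUnimodularRigidity (MinimiserShells)
open Summit.AtomisticToContinuum.Crystallization.Theorems.MinimiserShells.Negative.LoadBearing
  (eStar meanRootEnergy GoodShell not_goodShell_of_far e0 combPt combSize
    norm_combPt le_norm_combPt norm_combPt_le combPt_ne_zero combPt_injective dist_combPt
    lennardJones_le_on_comb_annulus ae_eq_dirac_count_restrict meanRootEnergy_dirac_count_restrict)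
open Summit.AtomisticToContinuum.Crystallization.Theorems.MinimiserShells.Negative.UniformRooting
  (rootedAt rootedMeasure unifRooted isProbabilityMeasure_unifRooted lintegral_rootedMeasure
    map_sub_rootedMeasure isPointStationaryLaw_unifRooted isRootedHardCore_rootedMeasure
    ae_isRootedHardCore_unifRooted meanRootEnergy_unifRooted integral_unifRooted
    ae_eq_dirac_rootedMeasure)

/-- Euclidean 3-space. -/
abbrev E3 := EuclideanSpace ℝ (Fin 3)

/-! ## §6c Two-point (reflection) symmetry is NOT enough: the Mecke identity must be used with
configuration-dependent transports

`IsReflectionSymmetricLaw P` is the Mecke identity restricted to transports `g(μ, y) = k(y)` that do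
not look at the configuration: `E_P Σ_y k(y) = E_P Σ_y k(−y)`.  Every point-stationary law has it;
the SYMMETRIC COMB (the comb of §2b together with its mirror image) has it too, with root energy
`≤ e*` and an empty shell.  So a proof must re-root at the neighbours GENUINELY (use `g` depending on
`θ_y μ`), not merely exploit the evenness of the Palm intensity. -/

/-- Reflection symmetry of the law: the Mecke identity for configuration-independent transports. -/
def IsReflectionSymmetricLaw (P : Measure (Measure E3)) : Prop :=
  ∀ k : E3 → ℝ≥0∞, Measurable k → ∫⁻ μ, ∫⁻ y, k y ∂μ ∂P = ∫⁻ μ, ∫⁻ y, k (-y) ∂μ ∂P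

/-- Point-stationary laws are reflection symmetric. [folklore] -/
theorem IsPointStationaryLaw.isReflectionSymmetricLaw {P : Measure (Measure E3)}
    (h : IsPointStationaryLaw P) : IsReflectionSymmetricLaw P :=
  fun k hk => h (fun _ y => k y) (hk.comp measurable_snd)

/-- The mirrored comb points `−(3/2 + k/(2(m+1))) • e₀`. -/
def negCombPt (m k : ℕ) : E3 := -combPt m k

/-- The symmetric comb: root, comb, mirrored comb. -/
def symComb (m : ℕ) : Finset E3 :=
  insert 0 ((Finset.range m).image (combPt m) ∪ (Finset.range m).image (negCombPt m))

/-- `‖e₀‖ = 1`. [folklore] -/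
theorem norm_e0' : ‖(e0 : E3)‖ = 1 := by simp [e0]

/-- Unfolding `combPt`. [folklore] -/
theorem combPt_eq_smul (m k : ℕ) :
    combPt m k = ((3 : ℝ) / 2 + (k : ℝ) / (2 * ((m : ℝ) + 1))) • e0 := rfl

/-- The comb coefficients are positive. [folklore] -/
theorem combCoeff_pos (m k : ℕ) : (0 : ℝ) < 3 / 2 + (k : ℝ) / (2 * ((m : ℝ) + 1)) := by positivity

/-- A comb point and a mirrored comb point are `≥ 3` apart. [folklore] -/
theorem dist_combPt_negCombPt (m k l : ℕ) : (3 : ℝ) ≤ dist (combPt m k) (negCombPt m l) := by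
  rw [negCombPt, dist_eq_norm, sub_neg_eq_add, combPt_eq_smul, combPt_eq_smul, ← add_smul, norm_smul,
    norm_e0', mul_one, Real.norm_of_nonneg (by positivity)]
  have h1 : (0 : ℝ) ≤ (k : ℝ) / (2 * ((m : ℝ) + 1)) := by positivity
  have h2 : (0 : ℝ) ≤ (l : ℝ) / (2 * ((m : ℝ) + 1)) := by positivity
  linarith

/-- Comb and mirrored comb are disjoint pointwise. [folklore] -/
theorem combPt_ne_negCombPt (m k l : ℕ) : combPt m k ≠ negCombPt m l := by
  intro h
  have := dist_combPt_negCombPt m k l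
  rw [h, dist_self] at this
  linarith

/-- [folklore] -/
theorem negCombPt_injective (m : ℕ) : Function.Injective (negCombPt m) :=
  fun _ _ h => combPt_injective m (neg_injective h)

/-- [folklore] -/
theorem disjoint_comb_images (m : ℕ) :
    Disjoint ((Finset.range m).image (combPt m)) ((Finset.range m).image (negCombPt m)) := by
  rw [Finset.disjoint_left]
  intro x hx hx'
  rw [Finset.mem_image] at hx hx'
  obtain ⟨k, -, rfl⟩ := hx
  obtain ⟨l, -, h⟩ := hx'
  exact combPt_ne_negCombPt m k l h.symm

/-- The root is not a comb point. [folklore] -/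
theorem zero_notMem_comb_images (m : ℕ) :
    (0 : E3) ∉ (Finset.range m).image (combPt m) ∪ (Finset.range m).image (negCombPt m) := by
  simp only [Finset.mem_union, Finset.mem_image, Finset.mem_range, not_or, not_exists, not_and]
  exact ⟨fun k _ => combPt_ne_zero m k, fun k _ h => combPt_ne_zero m k (neg_eq_zero.1 h)⟩

/-- Membership in the symmetric comb, unfolded. [folklore] -/
theorem mem_symComb {m : ℕ} {x : E3} (hx : x ∈ symComb m) :
    x = 0 ∨ (∃ k < m, x = combPt m k) ∨ (∃ k < m, x = negCombPt m k) := by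
  simp only [symComb, Finset.mem_insert, Finset.mem_union, Finset.mem_image, Finset.mem_range] at hx
  rcases hx with rfl | ⟨k, hk, rfl⟩ | ⟨k, hk, rfl⟩
  · exact Or.inl rfl
  · exact Or.inr (Or.inl ⟨k, hk, rfl⟩)
  · exact Or.inr (Or.inr ⟨k, hk, rfl⟩)

/-- [folklore] -/
theorem norm_negCombPt (m k : ℕ) : ‖negCombPt m k‖ = ‖combPt m k‖ := norm_neg _

/-- The symmetric comb is `1/(2(m+1))`-separated. [folklore] -/
theorem symComb_separated (m : ℕ) :
    ∀ x ∈ (↑(symComb m) : Set E3), ∀ y ∈ (↑(symComb m) : Set E3), x ≠ y →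
      1 / (2 * ((m : ℝ) + 1)) ≤ dist x y := by
  have hm : (0 : ℝ) < 2 * ((m : ℝ) + 1) := by positivity
  have hsmall : 1 / (2 * ((m : ℝ) + 1)) ≤ 3 / 2 := by
    rw [div_le_iff₀ hm]
    have : (0 : ℝ) ≤ m := by positivity
    linarith
  have hkl : ∀ k l : ℕ, k ≠ l → 1 / (2 * ((m : ℝ) + 1)) ≤ |(k : ℝ) - l| / (2 * ((m : ℝ) + 1)) :=
    fun k l hkl => by
    have : (1 : ℝ) ≤ |(k : ℝ) - l| := by
      rcases lt_or_gt_of_ne hkl with h | h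
      · have : (k : ℝ) + 1 ≤ l := by exact_mod_cast h
        rw [abs_of_neg (by linarith)]
        linarith
      · have : (l : ℝ) + 1 ≤ k := by exact_mod_cast h
        rw [abs_of_pos (by linarith)]
        linarith
    exact div_le_div_of_nonneg_right this hm.le
  intro x hx y hy hxy
  rcases mem_symComb (Finset.mem_coe.1 hx) with rfl | ⟨k, hk, rfl⟩ | ⟨k, hk, rfl⟩ <;>
    rcases mem_symComb (Finset.mem_coe.1 hy) with rfl | ⟨l, hl, rfl⟩ | ⟨l, hl, rfl⟩
  · exact absurd rfl hxy
  · rw [dist_comm, dist_zero_right]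
    exact hsmall.trans (le_norm_combPt m l)
  · rw [dist_comm, dist_zero_right, norm_negCombPt]
    exact hsmall.trans (le_norm_combPt m l)
  · rw [dist_zero_right]
    exact hsmall.trans (le_norm_combPt m k)
  · rw [dist_combPt]
    exact hkl k l fun h => hxy (by rw [h])
  · exact hsmall.trans (by linarith [dist_combPt_negCombPt m k l])
  · rw [dist_zero_right, norm_negCombPt]
    exact hsmall.trans (le_norm_combPt m k)
  · rw [dist_comm]
    exact hsmall.trans (by linarith [dist_combPt_negCombPt m l k])
  · rw [negCombPt, negCombPt, dist_neg_neg, dist_combPt]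
    exact hkl k l fun h => hxy (by rw [h])

/-- Hence a rooted hard-core configuration. [folklore] -/
theorem isRootedHardCore_symComb (m : ℕ) :
    IsRootedHardCore (1 / (2 * ((m : ℝ) + 1)))
      ((Measure.count : Measure E3).restrict (↑(symComb m) : Set E3)) :=
  ⟨↑(symComb m), by simp [symComb], symComb_separated m, rfl⟩

/-- Root energy of the symmetric comb: `≤ −m/1000`. [folklore] -/
theorem rootEnergy_symComb_le (m : ℕ) :
    (∫ y, lennardJones ‖y‖ ∂((Measure.count : Measure E3).restrict (↑(symComb m) : Set E3))) / 2 ≤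
      -((m : ℝ) / 1000) := by
  rw [integral_count_restrict_coe_finset, symComb, Finset.sum_insert (zero_notMem_comb_images m),
    norm_zero, lennardJones_zero, zero_add, Finset.sum_union (disjoint_comb_images m),
    Finset.sum_image fun k _ l _ h => combPt_injective m h,
    Finset.sum_image fun k _ l _ h => negCombPt_injective m h]
  simp_rw [norm_negCombPt]
  have hle : ∑ k ∈ Finset.range m, lennardJones ‖combPt m k‖ ≤
      ∑ k ∈ Finset.range m, (-(1 / 1000) : ℝ) :=
    Finset.sum_le_sum fun k hk => lennardJones_le_on_comb_annulus (le_norm_combPt m k)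
      (norm_combPt_le (Finset.mem_range.1 hk))
  rw [Finset.sum_const, Finset.card_range, nsmul_eq_mul] at hle
  linarith

/-- With `m = ⌈−2000 e*⌉₊` the root energy is `≤ e*`. [folklore] -/
theorem rootEnergy_symComb_le_eStar :
    (∫ y, lennardJones ‖y‖ ∂((Measure.count : Measure E3).restrict (↑(symComb combSize) : Set E3)))
      / 2 ≤ eStar := by
  have h1 := rootEnergy_symComb_le combSize
  have h2 : -2000 * eStar ≤ (combSize : ℝ) := Nat.le_ceil _
  have h3 : (0 : ℝ) ≤ combSize := Nat.cast_nonneg _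
  linarith

/-- The symmetric comb has an empty (bad) root shell. [folklore] -/
theorem not_goodShell_symComb (m : ℕ) :
    ¬ GoodShell ((Measure.count : Measure E3).restrict (↑(symComb m) : Set E3)) := by
  refine not_goodShell_of_far fun y hy hy0 => ?_
  rw [count_restrict_singleton_ne_zero_iff] at hy
  rcases mem_symComb (Finset.mem_coe.1 hy) with rfl | ⟨k, -, rfl⟩ | ⟨k, -, rfl⟩
  · exact absurd rfl hy0
  · exact lt_of_lt_of_le (by norm_num) (le_norm_combPt m k)
  · rw [norm_negCombPt]
    exact lt_of_lt_of_le (by norm_num) (le_norm_combPt m k)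

/-- The symmetric comb is symmetric: `Σ_{y} k(−y) = Σ_{y} k(y)` over it. [folklore] -/
theorem sum_symComb_neg (m : ℕ) (k : E3 → ℝ≥0∞) :
    ∑ y ∈ symComb m, k (-y) = ∑ y ∈ symComb m, k y := by
  have himage : (symComb m).image (fun y : E3 => -y) = symComb m := by
    ext x
    simp only [Finset.mem_image]
    constructor
    · rintro ⟨y, hy, rfl⟩
      rcases mem_symComb hy with rfl | ⟨j, hj, rfl⟩ | ⟨j, hj, rfl⟩
      · simp [symComb]
      · simp only [symComb, Finset.mem_insert, Finset.mem_union, Finset.mem_image, Finset.mem_range]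
        exact Or.inr (Or.inr ⟨j, hj, rfl⟩)
      · simp only [symComb, Finset.mem_insert, Finset.mem_union, Finset.mem_image, Finset.mem_range,
          negCombPt, neg_neg]
        exact Or.inr (Or.inl ⟨j, hj, rfl⟩)
    · intro hx
      rcases mem_symComb hx with rfl | ⟨j, hj, rfl⟩ | ⟨j, hj, rfl⟩
      · exact ⟨0, by simp [symComb], neg_zero⟩
      · refine ⟨negCombPt m j, ?_, neg_neg _⟩
        simp only [symComb, Finset.mem_insert, Finset.mem_union, Finset.mem_image, Finset.mem_range]
        exact Or.inr (Or.inr ⟨j, hj, rfl⟩)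
      · refine ⟨combPt m j, ?_, rfl⟩
        simp only [symComb, Finset.mem_insert, Finset.mem_union, Finset.mem_image, Finset.mem_range]
        exact Or.inr (Or.inl ⟨j, hj, rfl⟩)
  conv_rhs => rw [← himage]
  rw [Finset.sum_image fun x _ y _ h => neg_injective h]

/-- `∫⁻ k d(count|F) = Σ_{y ∈ F} k y` for a finite set (no measurability needed). [folklore] -/
theorem lintegral_count_restrict_coe_finset (F : Finset E3) (k : E3 → ℝ≥0∞) :
    ∫⁻ y, k y ∂((Measure.count : Measure E3).restrict (↑F : Set E3)) = ∑ y ∈ F, k y := by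
  rw [count_restrict_coe_finset, lintegral_finsetSum_measure]
  simp_rw [lintegral_dirac]

/-- The deterministic symmetric comb `δ_{count|symComb}` is reflection symmetric. [folklore] -/
theorem isReflectionSymmetricLaw_dirac_symComb (m : ℕ) :
    IsReflectionSymmetricLaw (Measure.dirac ((Measure.count : Measure E3).restrict
      (↑(symComb m) : Set E3))) := by
  intro k _
  have hae := ae_eq_dirac_count_restrict (symComb m)
  have ev : ∀ G : Measure E3 → ℝ≥0∞, ∫⁻ μ, G μ ∂(Measure.dirac ((Measure.count : Measure E3).restrict
      (↑(symComb m) : Set E3)) : Measure (Measure E3)) =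
      G ((Measure.count : Measure E3).restrict (↑(symComb m) : Set E3)) := fun G => by
    rw [lintegral_congr_ae (hae.mono fun μ hμ => by rw [hμ] :
      (fun μ => G μ) =ᵐ[_] fun _ => G ((Measure.count : Measure E3).restrict ↑(symComb m))),
      lintegral_const, measure_univ, mul_one]
  rw [ev fun μ => ∫⁻ y, k y ∂μ, ev fun μ => ∫⁻ y, k (-y) ∂μ, lintegral_count_restrict_coe_finset,
    lintegral_count_restrict_coe_finset, sum_symComb_neg]

/-- **Reflection symmetry does not substitute for point-stationarity.** Witness: the deterministic
symmetric comb. [folklore] -/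
theorem minimiserShells_false_withReflectionOnly :
    ¬ (∀ δ : ℝ, 0 < δ → ∀ P : Measure (Measure E3), IsProbabilityMeasure P →
      (∀ᵐ μ ∂P, IsRootedHardCore δ μ) → IsReflectionSymmetricLaw P → meanRootEnergy P ≤ eStar →
      ∀ᵐ μ ∂P, GoodShell μ) := by
  intro h
  set F := symComb combSize
  have hae := ae_eq_dirac_count_restrict F
  have hE : meanRootEnergy (Measure.dirac ((Measure.count : Measure E3).restrict (↑F : Set E3)))
      ≤ eStar := by
    rw [meanRootEnergy_dirac_count_restrict]
    exact rootEnergy_symComb_le_eStar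
  have hgood := h _ (by positivity : (0 : ℝ) < 1 / (2 * ((combSize : ℝ) + 1))) _ inferInstance
    (hae.mono fun μ hμ => by rw [hμ]; exact isRootedHardCore_symComb combSize)
    (isReflectionSymmetricLaw_dirac_symComb combSize) hE
  obtain ⟨μ, hμg, hμe⟩ := (hgood.and hae).exists
  rw [hμe] at hμg
  exact not_goodShell_symComb combSize hμg


end Summit.AtomisticToContinuum.Crystallization.Theorems.MinimiserShells.Negative.ReflectionOnly
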